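import Summits.AtomisticToContinuum.BoseEinsteinCondensation.Theses.BECDyadicChaining
import Summits.AtomisticToContinuum.BoseEinsteinCondensation.Theorems.BECDyadicChainingCoherentAmplitudeMonotone
import Summits.AtomisticToContinuum.BoseEinsteinCondensation.Theorems.BECDyadicChainingBaseCoherentMassBlockMassCapture
import Summits.AtomisticToContinuum.BoseEinsteinCondensation.Theorems.BECDyadicChainingBaseCoherentMassOccupationLeDensity
import Summits.AtomisticToContinuum.BoseEinsteinCondensation.Theorems.BECDyadicChainingBaseCoherentMassCellLedger
import Summits.AtomisticToContinuum.BoseEinsteinCondensation.Theorems.BECDyadicChainingBaseCoherentMassNoClumpingInteracting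
import Summits.AtomisticToContinuum.BoseEinsteinCondensation.Theorems.BECDyadicChainingBaseCoherentMassSineGap
import Summits.AtomisticToContinuum.BoseEinsteinCondensation.Theorems.BECDyadicChainingBaseCoherentMassFreeUpperBound
import Summits.AtomisticToContinuum.BoseEinsteinCondensation.Theorems.BECDyadicChainingBaseCoherentMassFreeBase
import Literature.MathematicalPhysics.QuantumManyBody.LiebYngvasonTheorem
import Literature.MathematicalPhysics.QuantumManyBody.LiebYngvasonCellMethod
import Literature.MathematicalPhysics.QuantumManyBody.DiluteBoseGasUpperBoundLocalization
import Literature.MathematicalPhysics.QuantumManyBody.PeriodicBoseGasScattering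
import Literature.MathematicalPhysics.QuantumManyBody.BoseGasThermodynamicLimitRuelle
import Literature.MathematicalPhysics.QuantumManyBody.BoseGasFreeDirichletBEC
import Literature.MathematicalPhysics.QuantumManyBody.PeriodicBoseGasLocalization

/-!
# Crux `BaseCoherentMass` (stmt-AtomisticToContinuum-13193) — line `registered` (birth), RESHAPED skeleton — CLOSED

All seven stubs landed and the crux is PROVED: closing file
`Summits/AtomisticToContinuum/BoseEinsteinCondensation/Theorems/BECDyadicChainingBaseCoherentMass.lean`
(`Summit.AtomisticToContinuum.BoseEinsteinCondensation.Theorems.baseCoherentMass_proof`, p148719, 2026-08-17).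
This workfile is the same composition over the landed stubs (sorry-free).

Route `BECDyadicChaining` of `AtomisticToContinuum/BoseEinsteinCondensation`, crux of rank 3
(`Summit.AtomisticToContinuum.BoseEinsteinCondensation.Theses.BECDyadicChaining.BaseCoherentMass`):
for every repulsive finite-range `v` and every `ℓ_d > 0`, at small density there is a base scale
`ℓ_b ≥ ℓ_d` such that, eventually in `N`, the dyadic level `K` with cube side `L/2^K ∈ [ℓ_b, 2ℓ_b)`
(`L = (N/ρ)^{1/3}`) has coherent amplitude `A_K = 8^{-K/2} Σ_B √n_B ≥ √N/2` on every near-minimiser.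

## The line, reshaped by the lead (2026-08-17)

The birth skeleton composed P (Poincaré block-mass capture) + E (kinetic budget) + Q (no clumping,
`Σ_B n_B² ≤ (15/4) N²/8^K`) through the tangent-line Hölder inequality. Q as filed is out of reach
of its own engine: the cell-wise Lieb–Yngvason box bound is quadratic in the cell occupation only up
to the Temple threshold and superadditivity is LINEAR beyond, so an energy budget `(1+o(1))·4πaρN`
cannot exclude a cell carrying mass `θN` (`θ = o_ρ(1)`, independent of `N`) with small probability —
its squared occupation `θ²N²` dwarfs `N²/8^K`. The composition never needed the untruncated second
moment: it suffices that `n_B ≤ m_B + o_B` with `Σ m_B² ≤ (15/4)N²/8^K` and `Σ o_B ≤ N/200`, since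
the Hölder step can be run on `n'_B = min(n_B, m_B)` (`Σ n' ≥ Σ n − Σ o`, `Σ n'² ≤ Σ m²`,
`Σ √n ≥ Σ √n'`). This truncated no-clumping IS what the engine gives (threshold `T` large, cells
holding `M…8M` particles on average). The free case `a(v) = 0` (then `v(|x|) = 0` a.e.) is split off
and proved directly and uniformly in the level: complete condensation of free Dirichlet
near-minimisers into the sine mode `s = ∏ √(2/L) sin(πx_k/L)` (one-body Dirichlet gap `3π²/L²` from
the tree's sine/cosine Parseval, plus the sharp free upper bound `E₀ ≤ 3π²N/L²`) gives
`A_K ≥ (2√2/π)³ √n₀ − √(N − n₀) ≥ √N/2` for every `K`.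

Stubs (sorries only here; each is one worker's obligation, the lead holds `stub_noClumpingInteracting`):
* `stub_blockMassCapture` (P): `N ≤ Σ_B n_B + (s²/π²) ∫|∇Ψ|²` (Neumann–Poincaré, `key_inequality`).
* `stub_occupationLeDensity`: `n_B ≤ Σ_j P(x_j ∈ B)` (Cauchy–Schwarz in the cube, Bose symmetry).
* `stub_cellLedger`: pure bookkeeping — weights over cell assignments, box bound + superadditivity +
  budget ⇒ the `(m, o)` ledger with `T·Σo + Σm² ≤ B + N`.
* `stub_noClumpingInteracting` (a > 0): the truncated no-clumping of near-minimisers (cell method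
  state-wise, LY box bound with crude constants at the interparticle scale, Dyson upper bound, the ledger).
* `stub_sineGap`: `6‖f‖² ≤ (L/π)²‖∇f‖² + 3|⟨s, f⟩|²` for `f ∈ C¹` vanishing off the box.
* `stub_freeUpperBound`: `E₀(0, N, L) ≤ 3π²N/L²`.
* `stub_freeBase`: sineGap → freeUpperBound → for free near-minimisers `√N ≤ 2A_K` at every level.
Proved in this file: the kinetic budget for `a > 0` (Dyson, `eventually_groundStateEnergy_le_dyson`),
`energy v = energy 0` when `v(|·|) = 0` a.e., and the composition `BaseCoherentMass_of` (both branches).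
-/

namespace Summit.AtomisticToContinuum.BoseEinsteinCondensation.Cruxes.BaseCoherentMass.Birth

open scoped BigOperators ENNReal ComplexConjugate
open Filter MeasureTheory
open Literature.MathematicalPhysics.QuantumManyBody.BoseGas

/-! ### The registered stubs -/

/-- **P — block mass capture (Neumann–Poincaré in the dyadic cubes); stub LANDED (p144337).** For every Dirichlet trial
state `Ψ` of `N` bosons in the box of side `L` and every level `K` (cube side `s = L/2^K`):
`N ≤ Σ_B ⟨φ_B, γ_Ψ φ_B⟩ + (s²/π²) ∫ |∇Ψ|²` over the flat modes `dyMode L K ·` of the half-open dyadic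
cells (the Neumann gap `π²/s²` of each cube, slice-wise in the first particle, Bose symmetry:
`key_inequality` of `BoseGasFreeDirichletBEC` multiplied by `(s/π)²`). [cite: LSSY2005, Ch. 5 (5.15)–(5.17)] -/
theorem blockMassCapture : ∀ (N : ℕ) (L : ℝ) (Ψ : TrialState N L) (K : ℕ),
    (N : ℝ≥0∞) ≤ (∑ i : Fin 3 → Fin (2 ^ K), occupation N (dyMode L K i) Ψ.ψ) +
      ENNReal.ofReal ((L / 2 ^ K) ^ 2 / Real.pi ^ 2) * ∫⁻ X, kineticDensity Ψ.ψ X :=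
  Summit.AtomisticToContinuum.BoseEinsteinCondensation.Theorems.BaseCoherentMass.stub_blockMassCapture

/-- **A flat-mode occupation is at most the expected number of particles in its cell; stub LANDED
(p144441).** `⟨φ_B, γ_Ψ φ_B⟩ ≤ Σ_j ∫_{x_j ∈ B} |Ψ|²` (Cauchy–Schwarz against the normalised flat mode
in the cube, then Bose symmetry). [cite: LSSY2005, §1.2 (1.17)] -/
theorem occupationLeDensity : ∀ (N : ℕ) (L : ℝ) (Ψ : TrialState N L) (K : ℕ)
    (i : Fin 3 → Fin (2 ^ K)),
    occupation N (dyMode L K i) Ψ.ψ ≤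
      ∑ j : Fin N, ∫⁻ X in {X : Config N | X j ∈ dyCell L K i}, (‖Ψ.ψ X‖₊ : ℝ≥0∞) ^ 2 :=
  Summit.AtomisticToContinuum.BoseEinsteinCondensation.Theorems.BaseCoherentMass.stub_occupationLeDensity

/-- **The cell-occupation ledger (pure bookkeeping behind LSSY (2.52)–(2.57)); stub LANDED (p144511).** Weights `w`
on assignments `s` (probabilities of the particle-to-cell configurations), occupation numbers `n s i`
summing to `N`, cell energies `E` with the box bound `E k ≥ c k(k-1)` for `k ≤ p` and superadditivity
`E(qp + r) ≥ q E(p)`, and the budget `Σ_s w_s Σ_i E(n s i) ≤ c B`. Then, with threshold `T`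
(`2T + 1 ≤ p`), splitting each cell's expected occupation into the moderately occupied part `m_i`
(`n ≤ T`, whose weighted square is controlled, Cauchy–Schwarz) and the over-occupied part `o_i`
(`n > T`, controlled linearly: `E k ≥ c T k` for `k > T`): `T Σ o + Σ m² ≤ B + N`. [cite: LSSY2005, (2.52)–(2.57)] -/
theorem cellLedger : ∀ {ι S : Type} [Fintype ι] [Fintype S] (w : S → ℝ≥0∞) (_hw : ∑ s, w s = 1)
    (n : S → ι → ℕ) (N : ℕ) (_hn : ∀ s, ∑ i, n s i = N) (E : ℕ → ℝ≥0∞) (c : ℝ) (_hc : 0 < c)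
    (p T : ℕ) (_hT : 2 * T + 1 ≤ p)
    (_hbox : ∀ k : ℕ, k ≤ p → ENNReal.ofReal (c * k * (k - 1)) ≤ E k)
    (_hsup : ∀ q r : ℕ, (q : ℝ≥0∞) * E p ≤ E (q * p + r))
    (B : ℝ) (_hB : 0 ≤ B) (_hbudget : ∑ s, w s * ∑ i, E (n s i) ≤ ENNReal.ofReal (c * B)),
    ∃ m o : ι → ℝ≥0∞, (∀ i, ∑ s, w s * (n s i : ℝ≥0∞) = m i + o i) ∧
      (∑ i, (m i + o i)) = (N : ℝ≥0∞) ∧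
      (T : ℝ≥0∞) * ∑ i, o i + ∑ i, m i ^ 2 ≤ ENNReal.ofReal B + N :=
  Summit.AtomisticToContinuum.BoseEinsteinCondensation.Theorems.BaseCoherentMass.stub_cellLedger

/-- **Q′ — truncated no-clumping of near-minimisers above the interparticle scale (`a > 0`); stub
LANDED (p145362, lead).**
For every repulsive finite-range `v` with `a(v) > 0` there are `M > 0` and `ρ₀ > 0` such that for
`0 < ρ < ρ₀`, eventually in `N`, for some `δ > 0`, every `δ`-near-minimiser `Ψ` of the Dirichlet energy
in the box of side `L = (N/ρ)^{1/3}` satisfies, at every level `K` whose cubes hold between `M` and `8M`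
particles on average: the expected cell numbers split as `Σ_j P(x_j ∈ B) ≤ m_B + o_B` with
`Σ_B m_B² ≤ (15/4) N²/8^K` and `Σ_B o_B ≤ N/200` (cell method state-wise, Lieb–Yngvason box bound with
crude constants + superadditivity against the Dyson upper bound, via `stub_cellLedger`).
[cite: LSSY2005, (2.52)–(2.54), Thm. 2.2; LiebYngvason1998] -/
theorem noClumpingInteracting :
    (∀ {ι S : Type} [Fintype ι] [Fintype S] (w : S → ℝ≥0∞) (_hw : ∑ s, w s = 1)
      (n : S → ι → ℕ) (N : ℕ) (_hn : ∀ s, ∑ i, n s i = N) (E : ℕ → ℝ≥0∞) (c : ℝ) (_hc : 0 < c)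
      (p T : ℕ) (_hT : 2 * T + 1 ≤ p)
      (_hbox : ∀ k : ℕ, k ≤ p → ENNReal.ofReal (c * k * (k - 1)) ≤ E k)
      (_hsup : ∀ q r : ℕ, (q : ℝ≥0∞) * E p ≤ E (q * p + r))
      (B : ℝ) (_hB : 0 ≤ B) (_hbudget : ∑ s, w s * ∑ i, E (n s i) ≤ ENNReal.ofReal (c * B)),
      ∃ m o : ι → ℝ≥0∞, (∀ i, ∑ s, w s * (n s i : ℝ≥0∞) = m i + o i) ∧
        (∑ i, (m i + o i)) = (N : ℝ≥0∞) ∧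
        (T : ℝ≥0∞) * ∑ i, o i + ∑ i, m i ^ 2 ≤ ENNReal.ofReal B + N) →
    ∀ v : ℝ → ℝ≥0∞, IsRepulsiveFiniteRange v → 0 < scatteringLength v →
    ∃ M : ℝ, 0 < M ∧ ∃ ρ₀ : ℝ, 0 < ρ₀ ∧ ∀ ρ : ℝ, 0 < ρ → ρ < ρ₀ → ∀ᶠ N : ℕ in Filter.atTop,
      ∃ δ : ℝ≥0∞, 0 < δ ∧ ∀ Ψ : TrialState N (sideLength ρ N),
        energy v Ψ ≤ groundStateEnergy v N (sideLength ρ N) + δ →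
        ∀ K : ℕ, M * 8 ^ K ≤ (N : ℝ) → (N : ℝ) < 8 * M * 8 ^ K →
          ∃ m o : (Fin 3 → Fin (2 ^ K)) → ℝ≥0∞,
            (∀ i, (∑ j : Fin N, ∫⁻ X in {X : Config N | X j ∈ dyCell (sideLength ρ N) K i},
                (‖Ψ.ψ X‖₊ : ℝ≥0∞) ^ 2) ≤ m i + o i) ∧
            ∑ i, m i ^ 2 ≤ ENNReal.ofReal (15 / 4 * (N : ℝ) ^ 2 / 8 ^ K) ∧
            ∑ i, o i ≤ ENNReal.ofReal ((N : ℝ) / 200) :=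
  Summit.AtomisticToContinuum.BoseEinsteinCondensation.Theorems.BaseCoherentMass.stub_noClumpingInteracting

/-- **The one-body Dirichlet gap of the cube in sine form; stub LANDED (worker).** For `L > 0` and `f ∈ C¹(ℝ³; ℂ)`
vanishing off the open box `(0,L)³`: `6 ∫|f|² ≤ (L/π)² ∫|∇f|² + 3 |∫ s f|²` with the normalised
ground mode `s(x) = ∏_k √(2/L) sin(π x_k/L)` — i.e. `-Δ_D ≥ 3π²/L² + (3π²/L²)(1 - |s⟩⟨s|)`: the
Dirichlet Laplacian of the cube has ground state `s`, energy `3π²/L²`, and gap `3π²/L²` (sine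
Parseval `hasSum_sq_integral_sin_mul` + cosine Parseval of the derivative, tensorised over the three
coordinates; `|k|² ≥ 6` for `k ∈ ℕ₊³ ∖ {(1,1,1)}`). [folklore; cite: LSSY2005, Ch. 2, after (2.50)] -/
theorem sineGap : ∀ (L : ℝ), 0 < L → ∀ f : Space → ℂ, ContDiff ℝ 1 f →
    (∀ x, x ∉ box L → f x = 0) →
    6 * ∫⁻ x, (‖f x‖₊ : ℝ≥0∞) ^ 2 ≤
      ENNReal.ofReal ((L / Real.pi) ^ 2) * (∫⁻ x, gradSqC f x) +
        3 * (‖∫ x, ((∏ k : Fin 3, (Real.sqrt (2 / L) * Real.sin (Real.pi * x k / L)) : ℝ) : ℂ) *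
          f x‖₊ : ℝ≥0∞) ^ 2 :=
  Summit.AtomisticToContinuum.BoseEinsteinCondensation.Theorems.BaseCoherentMass.stub_sineGap

/-- **The sharp free Dirichlet upper bound; stub LANDED (worker).** `E₀(0, N, L) ≤ 3π²N/L²` for the free gas in the
Dirichlet box of side `L > 0` (product trial states `∏ u_η(x_i)` with `u_η ∈ C¹` vanishing off the box
and Rayleigh quotient `↓ 3π²/L²`, e.g. the sine mode cut off smoothly near the faces; then
`le_of_forall_pos_le_add`). [folklore] -/
theorem freeUpperBound : ∀ (L : ℝ), 0 < L → ∀ N : ℕ,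
    groundStateEnergy 0 N L ≤ ENNReal.ofReal (3 * Real.pi ^ 2 / L ^ 2 * N) :=
  Summit.AtomisticToContinuum.BoseEinsteinCondensation.Theorems.BaseCoherentMass.stub_freeUpperBound

/-- **The free-gas base, uniformly in the level; stub LANDED (worker).** Given the sine gap and the sharp free upper
bound: for `L > 0`, `N ≥ 1` there is `δ > 0` such that every `δ`-near-minimiser `Ψ` of the FREE
Dirichlet energy has `√N ≤ 2 A_K(Ψ)` at EVERY level `K`. Route: the gap integrated over the slices
`x ↦ Ψ(x, Y)` gives `N - n₀ ≤ η` for the occupation `n₀` of `s` (`η` small with `δ`); decomposing each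
flat mode `φ_B = ⟨s, φ_B⟩ s + χ_B`, the Gram-vector triangle inequality in `L²(dY)`, Bessel for the
orthonormal flat modes applied to `(1 - |s⟩⟨s|)Ψ(·,Y)` and `Σ_B ⟨s, φ_B⟩ = 8^{K/2}(2√2/π)³` give
`A_K ≥ (2√2/π)³ √n₀ - √(N - n₀) ≥ √N/2`. [folklore; cite: LSSY2005, §1.2 (1.17)] -/
theorem freeBase :
    (∀ (L : ℝ), 0 < L → ∀ f : Space → ℂ, ContDiff ℝ 1 f →
      (∀ x, x ∉ box L → f x = 0) →
      6 * ∫⁻ x, (‖f x‖₊ : ℝ≥0∞) ^ 2 ≤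
        ENNReal.ofReal ((L / Real.pi) ^ 2) * (∫⁻ x, gradSqC f x) +
          3 * (‖∫ x, ((∏ k : Fin 3, (Real.sqrt (2 / L) * Real.sin (Real.pi * x k / L)) : ℝ) : ℂ) *
            f x‖₊ : ℝ≥0∞) ^ 2) →
    (∀ (L : ℝ), 0 < L → ∀ N : ℕ,
      groundStateEnergy 0 N L ≤ ENNReal.ofReal (3 * Real.pi ^ 2 / L ^ 2 * N)) →
    ∀ (N : ℕ) (L : ℝ), 0 < L → 0 < N →
      ∃ δ : ℝ≥0∞, 0 < δ ∧ ∀ Ψ : TrialState N L,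
        energy 0 Ψ ≤ groundStateEnergy 0 N L + δ →
        ∀ K : ℕ, (N : ℝ≥0∞) ^ (1 / 2 : ℝ) ≤
          2 * ((8 : ℝ≥0∞) ^ (-(K : ℝ) / 2) *
            ∑ i : Fin 3 → Fin (2 ^ K), (occupation N (dyMode L K i) Ψ.ψ) ^ (1 / 2 : ℝ)) :=
  Summit.AtomisticToContinuum.BoseEinsteinCondensation.Theorems.BaseCoherentMass.stub_freeBase

/-! ### Proved pieces: the kinetic budget (`a > 0`) and the free reduction (`a = 0`) -/

/-- **Kinetic budget (E), interacting case.** For repulsive finite-range `v` with `a > 0` and every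
`ε > 0`: at all small densities, eventually in `N`, `E₀(N, (N/ρ)^{1/3}) ≤ ε ρ^{2/3} N` — Dyson's upper
bound `4πρa(1 + C(ρa³)^{1/3})N` and `4πρa = 4πa ρ^{1/3} · ρ^{2/3}`. [cite: LSSY2005, Thm. 2.2 (2.14)–(2.15); Dyson1957] -/
theorem kineticBudget {v : ℝ → ℝ≥0∞} (hv : IsRepulsiveFiniteRange v) (ha : 0 < scatteringLength v)
    {ε : ℝ} (hε : 0 < ε) :
    ∃ ρ₀ : ℝ, 0 < ρ₀ ∧ ∀ ρ : ℝ, 0 < ρ → ρ < ρ₀ → ∀ᶠ N : ℕ in Filter.atTop,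
      groundStateEnergy v N (sideLength ρ N) ≤ ENNReal.ofReal (ε * ρ ^ (2 / 3 : ℝ) * N) := by
  obtain ⟨hvm, R₀, hR₀⟩ := hv
  have haT : scatteringLength v ≠ ⊤ := IsRepulsiveFiniteRange.scatteringLength_ne_top ⟨hvm, R₀, hR₀⟩
  obtain ⟨C, ρ₁, hC, hρ₁, H⟩ := eventually_groundStateEnergy_le_dyson hR₀ hvm haT ha
  set a : ℝ := (scatteringLength v).toReal with ha_def
  have ha0 : 0 < a := ENNReal.toReal_pos ha.ne' haT
  set t : ℝ := ε / (4 * Real.pi * a * (1 + C)) with ht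
  have ht0 : 0 < t := by positivity
  refine ⟨min ρ₁ (min (a ^ 3)⁻¹ (t ^ 3)), lt_min hρ₁ (lt_min (by positivity) (by positivity)), ?_⟩
  intro ρ hρ hρlt
  have hρ₁' : ρ < ρ₁ := hρlt.trans_le (min_le_left _ _)
  have hρa : ρ < (a ^ 3)⁻¹ := hρlt.trans_le ((min_le_right _ _).trans (min_le_left _ _))
  have hρt : ρ < t ^ 3 := hρlt.trans_le ((min_le_right _ _).trans (min_le_right _ _))
  filter_upwards [H ρ hρ hρ₁'] with N hN
  refine hN.trans (ENNReal.ofReal_le_ofReal ?_)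
  -- `4πρa(1 + C (ρa³)^{1/3}) ≤ ε ρ^{2/3}`
  have hY1 : (ρ * a ^ 3) ^ ((1 : ℝ) / 3) ≤ 1 := by
    refine Real.rpow_le_one (by positivity) ?_ (by norm_num)
    have : ρ * a ^ 3 < (a ^ 3)⁻¹ * a ^ 3 := mul_lt_mul_of_pos_right hρa (by positivity)
    rw [inv_mul_cancel₀ (by positivity)] at this
    exact this.le
  have hρ13 : ρ ^ ((1 : ℝ) / 3) ≤ t := by
    have h1 : ρ ^ ((1 : ℝ) / 3) ≤ (t ^ 3) ^ ((1 : ℝ) / 3) :=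
      Real.rpow_le_rpow hρ.le hρt.le (by norm_num)
    rwa [← Real.rpow_natCast, ← Real.rpow_mul ht0.le, show ((3 : ℕ) : ℝ) * (1 / 3) = 1 by norm_num,
      Real.rpow_one] at h1
  have hsplit : ρ = ρ ^ ((1 : ℝ) / 3) * ρ ^ ((2 : ℝ) / 3) := by
    rw [← Real.rpow_add hρ]; norm_num
  have hN0 : (0 : ℝ) ≤ N := Nat.cast_nonneg N
  have hρ23 : 0 ≤ ρ ^ ((2 : ℝ) / 3) := Real.rpow_nonneg hρ.le _
  have key : 4 * Real.pi * ρ * a * (1 + C * (ρ * a ^ 3) ^ ((1 : ℝ) / 3)) ≤ ε * ρ ^ ((2 : ℝ) / 3) := by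
    have h1 : 1 + C * (ρ * a ^ 3) ^ ((1 : ℝ) / 3) ≤ 1 + C := by nlinarith
    have h2 : 4 * Real.pi * a * (1 + C) * t = ε := by
      rw [ht]; field_simp
    calc 4 * Real.pi * ρ * a * (1 + C * (ρ * a ^ 3) ^ ((1 : ℝ) / 3))
        ≤ 4 * Real.pi * ρ * a * (1 + C) := by gcongr
      _ = 4 * Real.pi * a * (1 + C) * ρ ^ ((1 : ℝ) / 3) * ρ ^ ((2 : ℝ) / 3) := by
          conv_lhs => rw [hsplit]
          ring
      _ ≤ 4 * Real.pi * a * (1 + C) * t * ρ ^ ((2 : ℝ) / 3) := by gcongr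
      _ = ε * ρ ^ ((2 : ℝ) / 3) := by rw [h2]
  calc 4 * Real.pi * ρ * (scatteringLength v).toReal *
        (1 + C * (ρ * (scatteringLength v).toReal ^ 3) ^ ((1 : ℝ) / 3)) * N
      = 4 * Real.pi * ρ * a * (1 + C * (ρ * a ^ 3) ^ ((1 : ℝ) / 3)) * N := by rw [ha_def]
    _ ≤ ε * ρ ^ ((2 : ℝ) / 3) * N := mul_le_mul_of_nonneg_right key hN0
    _ = ε * ρ ^ (2 / 3 : ℝ) * N := by norm_num

/-- If `v(|x|) = 0` for a.e. `x ∈ ℝ³`, then for `i ≠ j` also `v(|xᵢ - xⱼ|) = 0` for a.e. configuration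
(the pair-difference map is a surjective linear map, `ae_comp_linearMap_mem_iff`). [folklore] -/
theorem ae_pairPotential_eq_zero {v : ℝ → ℝ≥0∞} (hv : Measurable v) (hv0 : ∀ᵐ x : Space, v ‖x‖ = 0)
    {N : ℕ} {i j : Fin N} (hij : i ≠ j) : ∀ᵐ X : Config N, v (dist (X i) (X j)) = 0 := by
  have hs : MeasurableSet {y : Space | v ‖y‖ = 0} :=
    hv.comp measurable_norm (measurableSet_singleton 0)
  let T : Config N →ₗ[ℝ] Space :=
    LinearMap.proj (R := ℝ) (φ := fun _ : Fin N => Space) i -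
      LinearMap.proj (R := ℝ) (φ := fun _ : Fin N => Space) j
  have hT : Function.Surjective T := fun y =>
    ⟨Pi.single i y, by simp [T, Pi.single_eq_of_ne hij.symm]⟩
  have h := (ae_comp_linearMap_mem_iff T volume volume hT hs).2 hv0
  filter_upwards [h] with X hX
  simpa [T, dist_eq_norm] using hX

/-- **Free reduction.** If `v(|x|) = 0` a.e. then every Dirichlet energy is the free one:
`energy v Ψ = energy 0 Ψ` (the interaction vanishes for a.e. configuration). [folklore] -/
theorem energy_eq_energy_zero {v : ℝ → ℝ≥0∞} (hv : Measurable v) (hv0 : ∀ᵐ x : Space, v ‖x‖ = 0)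
    {N : ℕ} {L : ℝ} (Ψ : TrialState N L) : energy v Ψ = energy 0 Ψ := by
  have hint : ∀ᵐ X : Config N, interaction v X = 0 := by
    have h : ∀ᵐ X : Config N, ∀ i j : Fin N, i ≠ j → v (dist (X i) (X j)) = 0 := by
      refine ae_all_iff.2 fun i => ae_all_iff.2 fun j => ?_
      by_cases hij : i = j
      · exact Filter.Eventually.of_forall fun X h => absurd hij h
      · exact (ae_pairPotential_eq_zero hv hv0 hij).mono fun X hX _ => hX
    refine h.mono fun X hX => ?_
    refine Finset.sum_eq_zero fun i _ => Finset.sum_eq_zero fun j hj => ?_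
    exact hX i j (Finset.mem_filter.1 hj).2.ne
  unfold energy
  refine lintegral_congr_ae ?_
  filter_upwards [hint] with X hX
  have h0 : interaction 0 X = 0 := by simp [interaction]
  rw [hX, h0]

/-- With `v(|x|) = 0` a.e. the Dirichlet ground-state energy is the free one. [folklore] -/
theorem groundStateEnergy_eq_zero_pot {v : ℝ → ℝ≥0∞} (hv : Measurable v)
    (hv0 : ∀ᵐ x : Space, v ‖x‖ = 0) (N : ℕ) (L : ℝ) :
    groundStateEnergy v N L = groundStateEnergy 0 N L :=
  iInf_congr fun Ψ => energy_eq_energy_zero hv hv0 Ψ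

/-! ### The composition -/

/-- A dyadic level in the bracket `[ℓ_b, 2ℓ_b)` exists once `L ≥ ℓ_b > 0`. [folklore] -/
theorem exists_level {ℓb L : ℝ} (hℓb : 0 < ℓb) (hL : ℓb ≤ L) :
    ∃ K : ℕ, ℓb ≤ L / 2 ^ K ∧ L / 2 ^ K < 2 * ℓb := by
  have hx : 1 ≤ L / ℓb := by rw [le_div_iff₀ hℓb, one_mul]; exact hL
  obtain ⟨K, h1, h2⟩ := exists_nat_pow_near hx one_lt_two
  refine ⟨K, ?_, ?_⟩
  · rw [le_div_iff₀ (pow_pos two_pos K)]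
    have h3 := (le_div_iff₀ hℓb).mp h1
    linarith [mul_comm ℓb ((2 : ℝ) ^ K)]
  · rw [div_lt_iff₀ (pow_pos two_pos K)]
    have h3 := (div_lt_iff₀ hℓb).mp h2
    calc L < 2 ^ (K + 1) * ℓb := h3
      _ = 2 * ℓb * 2 ^ K := by ring

/-- The route's OPEN dyadic cube flat mode has the same occupation as `dyMode` (they agree a.e.).
[folklore] -/
theorem occupation_openMode_eq (N : ℕ) (L : ℝ) (K : ℕ) (i : Fin 3 → Fin (2 ^ K)) (Ψ : Config N → ℂ) :
    occupation N (Set.indicator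
      {x : EuclideanSpace ℝ (Fin 3) | ∀ k : Fin 3, x k ∈ Set.Ioo (((i k : ℕ) : ℝ) * (L / 2 ^ K))
        ((((i k : ℕ) : ℝ) + 1) * (L / 2 ^ K))}
      (fun _ => ((Real.sqrt ((L / 2 ^ K) ^ 3))⁻¹ : ℂ))) Ψ = occupation N (dyMode L K i) Ψ :=
  occupation_congr_ae (indicator_ae_eq_of_ae_eq_set
    (Summit.AtomisticToContinuum.BoseEinsteinCondensation.Theorems.CoherentAmplitudeMonotone.openCell_ae_eq_dyCell
      L K i)) Ψ

/-- **Tangent-line Hölder, truncated.** If `n_i ≤ m_i + o_i` (cells `i` of a level with `8^K` cubes),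
`ofReal(199N/200) ≤ Σ n`, `Σ m² ≤ ofReal((15/4)N²/8^K)` and `Σ o ≤ ofReal(N/200)`, then
`√N ≤ 2 · 8^{-K/2} Σ √n`: run `a n' ≤ √n' + (4a³/27) n'²` on `n' = min(n, m)` with
`a = (3/4)·8^{K/2}/√N` (`Σ n' ≥ 0.99N`, `Σ n'² ≤ Σ m²`) — `297/400 - 15/64 ≥ 1/2`. [folklore] -/
theorem sqrt_le_two_coherentAmplitude_of_ledger {ι : Type} [Fintype ι] {N K : ℕ} (hN : 0 < N)
    (n m o : ι → ℝ≥0∞) (hle : ∀ i, n i ≤ m i + o i)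
    (hS1 : ENNReal.ofReal (199 / 200 * (N : ℝ)) ≤ ∑ i, n i)
    (hm : ∑ i, m i ^ 2 ≤ ENNReal.ofReal (15 / 4 * (N : ℝ) ^ 2 / 8 ^ K))
    (ho : ∑ i, o i ≤ ENNReal.ofReal ((N : ℝ) / 200)) :
    (N : ℝ≥0∞) ^ (1 / 2 : ℝ) ≤ 2 * ((8 : ℝ≥0∞) ^ (-(K : ℝ) / 2) * ∑ i, (n i) ^ (1 / 2 : ℝ)) := by
  classical
  -- (0) two elementary inequalities: `a s² ≤ s + (4a³/27) s⁴` on `ℝ≥0`, and its `ℝ≥0∞` form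
  have keyR : ∀ a s : ℝ, 0 ≤ a → 0 ≤ s → a * s ^ 2 ≤ s + 4 * a ^ 3 / 27 * (s ^ 2) ^ 2 := by
    intro a s ha hs
    have h1 : 0 ≤ s * ((a * s + 3) * (2 * (a * s) - 3) ^ 2) := by positivity
    nlinarith [h1]
  have key : ∀ a : ℝ, 0 ≤ a → ∀ x : ℝ≥0∞,
      ENNReal.ofReal a * x ≤ x ^ (1 / 2 : ℝ) + ENNReal.ofReal (4 * a ^ 3 / 27) * x ^ 2 := by
    intro a ha x
    rcases eq_or_ne x ⊤ with hx | hx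
    · rw [hx, ENNReal.top_rpow_of_pos (by norm_num : (0 : ℝ) < 1 / 2), top_add]
      exact le_top
    · have hy0 : 0 ≤ x.toReal := ENNReal.toReal_nonneg
      have hr := keyR a (Real.sqrt x.toReal) ha (Real.sqrt_nonneg _)
      rw [Real.sq_sqrt hy0, Real.sqrt_eq_rpow] at hr
      calc ENNReal.ofReal a * x = ENNReal.ofReal (a * x.toReal) := by
            rw [ENNReal.ofReal_mul ha, ENNReal.ofReal_toReal hx]
        _ ≤ ENNReal.ofReal (x.toReal ^ (1 / 2 : ℝ) + 4 * a ^ 3 / 27 * x.toReal ^ 2) :=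
            ENNReal.ofReal_le_ofReal hr
        _ = x ^ (1 / 2 : ℝ) + ENNReal.ofReal (4 * a ^ 3 / 27) * x ^ 2 := by
            rw [ENNReal.ofReal_add (Real.rpow_nonneg hy0 _) (by positivity),
              ← ENNReal.ofReal_rpow_of_nonneg hy0 (by norm_num : (0 : ℝ) ≤ 1 / 2),
              ENNReal.ofReal_mul (by positivity : (0 : ℝ) ≤ 4 * a ^ 3 / 27),
              ENNReal.ofReal_pow hy0, ENNReal.ofReal_toReal hx]
  -- (1) the truncated occupations
  set n' : ι → ℝ≥0∞ := fun i => min (n i) (m i) with hn'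
  have hn'le : ∀ i, n i ≤ n' i + o i := by
    intro i
    rcases le_total (n i) (m i) with h | h
    · rw [hn']; simp only [min_eq_left h]; exact le_self_add
    · rw [hn']; simp only [min_eq_right h]; exact hle i
  have hS1' : ENNReal.ofReal (99 / 100 * (N : ℝ)) ≤ ∑ i, n' i := by
    have h1 : ∑ i, n i ≤ ∑ i, n' i + ENNReal.ofReal ((N : ℝ) / 200) := by
      calc ∑ i, n i ≤ ∑ i, (n' i + o i) := Finset.sum_le_sum fun i _ => hn'le i
        _ = ∑ i, n' i + ∑ i, o i := Finset.sum_add_distrib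
        _ ≤ ∑ i, n' i + ENNReal.ofReal ((N : ℝ) / 200) := add_le_add le_rfl ho
    have h2 : ENNReal.ofReal (199 / 200 * (N : ℝ)) =
        ENNReal.ofReal (99 / 100 * (N : ℝ)) + ENNReal.ofReal ((N : ℝ) / 200) := by
      rw [← ENNReal.ofReal_add (by positivity) (by positivity)]
      congr 1; ring
    have h3 := hS1.trans h1
    rw [h2] at h3
    exact (ENNReal.add_le_add_iff_right ENNReal.ofReal_ne_top).mp h3
  have hS2' : ∑ i, (n' i) ^ 2 ≤ ENNReal.ofReal (15 / 4 * (N : ℝ) ^ 2 / 8 ^ K) :=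
    (Finset.sum_le_sum fun i _ => pow_le_pow_left' (min_le_right _ _) 2).trans hm
  have hmono : ∑ i, (n' i) ^ (1 / 2 : ℝ) ≤ ∑ i, (n i) ^ (1 / 2 : ℝ) :=
    Finset.sum_le_sum fun i _ => ENNReal.rpow_le_rpow (min_le_left _ _) (by norm_num)
  -- (2) tangent-line Hölder: `a Σn' ≤ Σ√n' + (4a³/27) Σn'²` with `a = (3/4) u/w`, `u = √(8^K)`, `w = √N`
  have hNpos : (0 : ℝ) < N := Nat.cast_pos.mpr hN
  have h8K : (0 : ℝ) < 8 ^ K := pow_pos (by norm_num) K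
  set u : ℝ := Real.sqrt (8 ^ K) with hu
  set w : ℝ := Real.sqrt N with hw
  have hu0 : 0 < u := Real.sqrt_pos.mpr h8K
  have hw0 : 0 < w := Real.sqrt_pos.mpr hNpos
  have hu2 : u ^ 2 = 8 ^ K := Real.sq_sqrt h8K.le
  have hw2 : w ^ 2 = (N : ℝ) := Real.sq_sqrt hNpos.le
  set a : ℝ := 3 / 4 * (u / w) with ha
  have ha0 : 0 ≤ a := by positivity
  have hsum : ENNReal.ofReal a * (∑ i, n' i) ≤
      (∑ i, (n' i) ^ (1 / 2 : ℝ)) + ENNReal.ofReal (4 * a ^ 3 / 27) * ∑ i, (n' i) ^ 2 := by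
    rw [Finset.mul_sum, Finset.mul_sum, ← Finset.sum_add_distrib]
    exact Finset.sum_le_sum fun i _ => key a ha0 (n' i)
  have hB0 : (0 : ℝ) ≤ 4 * a ^ 3 / 27 * (15 / 4 * (N : ℝ) ^ 2 / 8 ^ K) := by positivity
  have hAB : ENNReal.ofReal (a * (99 / 100 * (N : ℝ))) ≤ (∑ i, (n' i) ^ (1 / 2 : ℝ)) +
      ENNReal.ofReal (4 * a ^ 3 / 27 * (15 / 4 * (N : ℝ) ^ 2 / 8 ^ K)) :=
    calc ENNReal.ofReal (a * (99 / 100 * (N : ℝ)))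
        = ENNReal.ofReal a * ENNReal.ofReal (99 / 100 * (N : ℝ)) := ENNReal.ofReal_mul ha0
      _ ≤ ENNReal.ofReal a * ∑ i, n' i := mul_le_mul' le_rfl hS1'
      _ ≤ (∑ i, (n' i) ^ (1 / 2 : ℝ)) + ENNReal.ofReal (4 * a ^ 3 / 27) * ∑ i, (n' i) ^ 2 := hsum
      _ ≤ (∑ i, (n' i) ^ (1 / 2 : ℝ)) +
            ENNReal.ofReal (4 * a ^ 3 / 27) * ENNReal.ofReal (15 / 4 * (N : ℝ) ^ 2 / 8 ^ K) :=
          add_le_add le_rfl (mul_le_mul' le_rfl hS2')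
      _ = (∑ i, (n' i) ^ (1 / 2 : ℝ)) +
            ENNReal.ofReal (4 * a ^ 3 / 27 * (15 / 4 * (N : ℝ) ^ 2 / 8 ^ K)) := by
          rw [(ENNReal.ofReal_mul (by positivity : (0 : ℝ) ≤ 4 * a ^ 3 / 27)).symm]
  have hA : a * (99 / 100 * (N : ℝ)) = 297 / 400 * (u * w) := by
    rw [ha, ← hw2]
    calc 3 / 4 * (u / w) * (99 / 100 * w ^ 2) = 297 / 400 * (u * w) * (w / w) := by ring
      _ = 297 / 400 * (u * w) := by rw [div_self hw0.ne', mul_one]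
  have hB : 4 * a ^ 3 / 27 * (15 / 4 * (N : ℝ) ^ 2 / 8 ^ K) = 15 / 64 * (u * w) := by
    rw [ha, ← hw2, ← hu2]
    calc 4 * (3 / 4 * (u / w)) ^ 3 / 27 * (15 / 4 * (w ^ 2) ^ 2 / u ^ 2)
        = 15 / 64 * (u * w) * ((u / u) ^ 2 * (w / w) ^ 3) := by ring
      _ = 15 / 64 * (u * w) := by rw [div_self hu0.ne', div_self hw0.ne']; ring
  have hT : ENNReal.ofReal (u * w / 2) ≤ ∑ i, (n' i) ^ (1 / 2 : ℝ) := by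
    have h1 : ENNReal.ofReal (a * (99 / 100 * (N : ℝ))) -
        ENNReal.ofReal (4 * a ^ 3 / 27 * (15 / 4 * (N : ℝ) ^ 2 / 8 ^ K)) ≤ ∑ i, (n' i) ^ (1 / 2 : ℝ) :=
      tsub_le_iff_right.mpr hAB
    have h2 : ENNReal.ofReal (a * (99 / 100 * (N : ℝ)) - 4 * a ^ 3 / 27 * (15 / 4 * (N : ℝ) ^ 2 / 8 ^ K)) ≤
        ∑ i, (n' i) ^ (1 / 2 : ℝ) := by
      rw [ENNReal.ofReal_sub _ hB0]; exact h1
    rw [hA, hB] at h2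
    refine (ENNReal.ofReal_le_ofReal ?_).trans h2
    nlinarith [mul_pos hu0 hw0]
  -- (3) conclusion: `√N = w`, `8^{-K/2} = u⁻¹`, and `2 · u⁻¹ · (u w / 2) = w`
  have hN12 : (N : ℝ≥0∞) ^ (1 / 2 : ℝ) = ENNReal.ofReal w := by
    rw [← ENNReal.ofReal_natCast, ENNReal.ofReal_rpow_of_nonneg (Nat.cast_nonneg N)
      (by norm_num : (0 : ℝ) ≤ 1 / 2), hw, Real.sqrt_eq_rpow]
  have h8nn : (0 : ℝ) ≤ 8 := by norm_num
  have h8 : (8 : ℝ≥0∞) ^ (-(K : ℝ) / 2) = ENNReal.ofReal u⁻¹ := by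
    rw [show (8 : ℝ≥0∞) = ENNReal.ofReal 8 by norm_num,
      ENNReal.ofReal_rpow_of_pos (by norm_num : (0 : ℝ) < 8)]
    congr 1
    rw [neg_div, Real.rpow_neg h8nn, show (K : ℝ) / 2 = (K : ℝ) * (1 / 2) by ring, hu,
      Real.sqrt_eq_rpow, ← Real.rpow_natCast, ← Real.rpow_mul h8nn]
  have hre : 2 * (u⁻¹ * (u * w / 2)) = w := by
    rw [show 2 * (u⁻¹ * (u * w / 2)) = (u⁻¹ * u) * w by ring, inv_mul_cancel₀ hu0.ne', one_mul]
  have hfin : ENNReal.ofReal w = 2 * (ENNReal.ofReal u⁻¹ * ENNReal.ofReal (u * w / 2)) := by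
    rw [← ENNReal.ofReal_mul (inv_nonneg.mpr hu0.le), show (2 : ℝ≥0∞) = ENNReal.ofReal 2 by norm_num,
      ← ENNReal.ofReal_mul (by norm_num : (0 : ℝ) ≤ 2), hre]
  rw [hN12, h8, hfin]
  exact mul_le_mul' le_rfl (mul_le_mul' le_rfl (hT.trans hmono))

/-- **Assembly / skeleton theorem (composition proved, sorries only inside the stubs it invokes),
concluding the crux `BaseCoherentMass` BY NAME.** Free case `a = 0`: `v(|·|) = 0` a.e.
(`LSSY2005_zeroScatteringLength_holds`), energies are the free ones, `ℓ_b = ℓ_d`, any `ρ`, and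
`stub_freeBase` at the bracket level. Interacting case `a > 0`: base scale `ℓ_b = (M/ρ)^{1/3}`
(`M` from `stub_noClumpingInteracting`), level `K` with `L/2^K ∈ [ℓ_b, 2ℓ_b)` so that `M 8^K ≤ N < 8M 8^K`,
`δ = min δ_Q 1`; P + E (`ε = π²/(1600 M^{2/3})`) give `Σ_B n_B ≥ (199/200)N`; occupations are dominated by
expected cell numbers (`stub_occupationLeDensity`) which split as `m + o`; truncated tangent-line Hölder. -/
theorem BaseCoherentMass_of :
    Summit.AtomisticToContinuum.BoseEinsteinCondensation.Theses.BECDyadicChaining.BaseCoherentMass := by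
  intro v hv ℓd hℓd
  classical
  obtain ⟨hvm, R₀, hR₀⟩ := id hv
  rcases eq_or_ne (scatteringLength v) 0 with ha0 | ha0
  · /- the free case `a = 0` -/
    have hv0 : ∀ᵐ x : Space, v ‖x‖ = 0 := LSSY2005_zeroScatteringLength_holds v R₀ hvm hR₀ ha0
    refine ⟨1, one_pos, fun ρ hρ _ => ⟨ℓd, le_rfl, ?_⟩⟩
    filter_upwards [(tendsto_sideLength_atTop hρ).eventually_ge_atTop ℓd, Filter.eventually_gt_atTop 0]
      with N hNL hN0
    obtain ⟨K, hK1, hK2⟩ := exists_level hℓd hNL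
    have hL : 0 < sideLength ρ N := hℓd.trans_le hNL
    obtain ⟨δ, hδ, HΨ⟩ := freeBase sineGap freeUpperBound N (sideLength ρ N) hL hN0
    refine ⟨K, hK1, hK2, δ, hδ, fun Ψ hΨ => ?_⟩
    have hΨ0 : energy 0 Ψ ≤ groundStateEnergy 0 N (sideLength ρ N) + δ := by
      rw [← energy_eq_energy_zero hvm hv0 Ψ, ← groundStateEnergy_eq_zero_pot hvm hv0]
      exact hΨ
    have h := HΨ Ψ hΨ0 K
    simp only [occupation_openMode_eq]
    exact h
  · /- the interacting case `a > 0` -/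
    have ha : 0 < scatteringLength v := pos_iff_ne_zero.mpr ha0
    -- (1) data of the no-clumping stub; the Poincaré budget `ε`; the kinetic budget at this `ε`
    obtain ⟨M, hM, ρQ, hρQ, HQ⟩ := noClumpingInteracting cellLedger v hv ha
    have hM23 : 0 < M ^ (2 / 3 : ℝ) := Real.rpow_pos_of_pos hM _
    set ε : ℝ := Real.pi ^ 2 / (1600 * M ^ (2 / 3 : ℝ)) with hε
    have hεpos : 0 < ε := by positivity
    obtain ⟨ρE, hρE, HE⟩ := kineticBudget hv ha hεpos
    have hℓd3 : 0 < ℓd ^ 3 := by positivity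
    refine ⟨min (min ρQ ρE) (M / ℓd ^ 3), lt_min (lt_min hρQ hρE) (div_pos hM hℓd3), ?_⟩
    intro ρ hρ hρlt
    have hρQ' : ρ < ρQ := hρlt.trans_le ((min_le_left _ _).trans (min_le_left _ _))
    have hρE' : ρ < ρE := hρlt.trans_le ((min_le_left _ _).trans (min_le_right _ _))
    have hρℓ : ρ < M / ℓd ^ 3 := hρlt.trans_le (min_le_right _ _)
    have hρ23 : 0 < ρ ^ (2 / 3 : ℝ) := Real.rpow_pos_of_pos hρ _
    -- (2) the base scale `ℓ_b = (M/ρ)^{1/3}`: cubes of side `≥ ℓ_b` hold `≥ M` particles on average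
    have hMρ : 0 < M / ρ := div_pos hM hρ
    set ℓb : ℝ := (M / ρ) ^ (1 / 3 : ℝ) with hℓb
    have hℓbpos : 0 < ℓb := Real.rpow_pos_of_pos hMρ _
    have hℓb3 : ℓb ^ 3 = M / ρ := by
      rw [hℓb, ← Real.rpow_natCast, ← Real.rpow_mul hMρ.le]; norm_num
    have hℓb2 : ℓb ^ 2 * ρ ^ (2 / 3 : ℝ) = M ^ (2 / 3 : ℝ) := by
      have e1 : ℓb ^ 2 = (M / ρ) ^ (2 / 3 : ℝ) := by
        rw [hℓb, ← Real.rpow_natCast, ← Real.rpow_mul hMρ.le]; norm_num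
      rw [e1, ← Real.mul_rpow hMρ.le hρ.le, div_mul_cancel₀ M hρ.ne']
    have hℓdb : ℓd ≤ ℓb := by
      have h1 : ℓd ^ 3 < ℓb ^ 3 := by
        rw [hℓb3, lt_div_iff₀ hρ]
        have h2 := (lt_div_iff₀ hℓd3).mp hρℓ
        linarith [mul_comm ρ (ℓd ^ 3)]
      by_contra hcon
      have h3 : ℓb ^ 3 ≤ ℓd ^ 3 := pow_le_pow_left₀ hℓbpos.le (not_le.mp hcon).le 3
      linarith
    refine ⟨ℓb, hℓdb, ?_⟩
    -- (3) eventualities in `N`: the two stubs, `L ≥ ℓ_b`, and the `δ ≤ 1` slack is `≤ N/400`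
    have EL : ∀ᶠ N : ℕ in Filter.atTop, ℓb ≤ sideLength ρ N :=
      (tendsto_sideLength_atTop hρ).eventually_ge_atTop ℓb
    have E1 : ∀ᶠ N : ℕ in Filter.atTop, 4 * ℓb ^ 2 / Real.pi ^ 2 ≤ (N : ℝ) / 400 := by
      filter_upwards [Filter.eventually_ge_atTop ⌈400 * (4 * ℓb ^ 2 / Real.pi ^ 2)⌉₊] with N hN
      have h1 : 400 * (4 * ℓb ^ 2 / Real.pi ^ 2) ≤ (N : ℝ) :=
        (Nat.le_ceil _).trans (by exact_mod_cast hN)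
      linarith
    filter_upwards [HQ ρ hρ hρQ', HE ρ hρ hρE', EL, E1, Filter.eventually_gt_atTop 0] with N hNQ hNE
      hNL hN1 hN0
    obtain ⟨δQ, hδQ, HΨQ⟩ := hNQ
    have hNpos : (0 : ℝ) < N := Nat.cast_pos.mpr hN0
    have hL3 : sideLength ρ N ^ 3 = N / ρ := by
      have h0 : (0 : ℝ) ≤ N / ρ := div_nonneg (Nat.cast_nonneg N) hρ.le
      rw [sideLength, ← Real.rpow_natCast, ← Real.rpow_mul h0]; norm_num
    -- (4) the base level `K`: `L/2^K ∈ [ℓ_b, 2ℓ_b)`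
    obtain ⟨K, hK1, hK2⟩ := exists_level hℓbpos hNL
    have h8K : (0 : ℝ) < 8 ^ K := pow_pos (by norm_num) K
    set L : ℝ := sideLength ρ N with hLdef
    have hcube : (L / 2 ^ K) ^ 3 = (N : ℝ) / ρ / 8 ^ K := by
      rw [div_pow, hL3, ← pow_mul, mul_comm K 3, pow_mul]; norm_num
    have hMK : M * 8 ^ K ≤ (N : ℝ) := by
      have h1 : ℓb ^ 3 ≤ (L / 2 ^ K) ^ 3 := pow_le_pow_left₀ hℓbpos.le hK1 3
      rw [hℓb3, hcube, le_div_iff₀ h8K, div_mul_eq_mul_div, div_le_div_iff_of_pos_right hρ] at h1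
      exact h1
    have hMK' : (N : ℝ) < 8 * M * 8 ^ K := by
      have h0 : 0 ≤ L / 2 ^ K := hℓbpos.le.trans hK1
      have h1 : (L / 2 ^ K) ^ 3 < (2 * ℓb) ^ 3 := pow_lt_pow_left₀ hK2 h0 (by norm_num)
      rw [hcube, mul_pow, hℓb3, div_lt_iff₀ h8K, div_lt_iff₀ hρ] at h1
      have : (2 : ℝ) ^ 3 * (M / ρ) * 8 ^ K * ρ = 8 * M * 8 ^ K * (ρ / ρ) := by ring
      rw [this, div_self hρ.ne', mul_one] at h1
      exact h1
    have hsK : (L / 2 ^ K) ^ 2 ≤ 4 * ℓb ^ 2 := by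
      have h0 : 0 ≤ L / 2 ^ K := hℓbpos.le.trans hK1
      calc (L / 2 ^ K) ^ 2 ≤ (2 * ℓb) ^ 2 := pow_le_pow_left₀ h0 hK2.le 2
        _ = 4 * ℓb ^ 2 := by ring
    -- (5) the slack `δ = min δ_Q 1` and a near-minimiser `Ψ`
    refine ⟨K, hK1, hK2, min δQ 1, lt_min hδQ one_pos, fun Ψ hΨ => ?_⟩
    simp only [occupation_openMode_eq]
    set n : (Fin 3 → Fin (2 ^ K)) → ℝ≥0∞ := fun i => occupation N (dyMode L K i) Ψ.ψ with hn
    -- the inputs at level `K`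
    obtain ⟨m, o, hmo, hm2, ho⟩ :=
      HΨQ Ψ (hΨ.trans (add_le_add le_rfl (min_le_left _ _))) K hMK hMK'
    have hle : ∀ i, n i ≤ m i + o i := fun i =>
      (occupationLeDensity N L Ψ K i).trans (hmo i)
    have hPK : (N : ℝ≥0∞) ≤ (∑ i, n i) +
        ENNReal.ofReal ((L / 2 ^ K) ^ 2 / Real.pi ^ 2) * ∫⁻ X, kineticDensity Ψ.ψ X :=
      blockMassCapture N L Ψ K
    have hkin : ∫⁻ X, kineticDensity Ψ.ψ X ≤ ENNReal.ofReal (ε * ρ ^ (2 / 3 : ℝ) * N) + 1 :=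
      calc ∫⁻ X, kineticDensity Ψ.ψ X ≤ energy v Ψ := lintegral_mono fun X => le_self_add
        _ ≤ groundStateEnergy v N L + min δQ 1 := hΨ
        _ ≤ ENNReal.ofReal (ε * ρ ^ (2 / 3 : ℝ) * N) + 1 := add_le_add hNE (min_le_right _ _)
    -- (6) the Poincaré loss is at most `N/200`, so `Σ_B n_B ≥ (199/200) N`
    have hloss : (L / 2 ^ K) ^ 2 / Real.pi ^ 2 * (ε * ρ ^ (2 / 3 : ℝ) * N + 1) ≤ (N : ℝ) / 200 := by
      have hπ : 0 < Real.pi ^ 2 := by positivity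
      have hX : 0 ≤ ε * ρ ^ (2 / 3 : ℝ) * N + 1 := by positivity
      have h1 : (L / 2 ^ K) ^ 2 / Real.pi ^ 2 ≤ 4 * ℓb ^ 2 / Real.pi ^ 2 :=
        div_le_div_of_nonneg_right hsK hπ.le
      have h2 : 4 * ℓb ^ 2 / Real.pi ^ 2 * (ε * ρ ^ (2 / 3 : ℝ) * N) = (N : ℝ) / 400 := by
        rw [hε, ← hℓb2]
        field_simp
        ring
      calc (L / 2 ^ K) ^ 2 / Real.pi ^ 2 * (ε * ρ ^ (2 / 3 : ℝ) * N + 1)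
          ≤ 4 * ℓb ^ 2 / Real.pi ^ 2 * (ε * ρ ^ (2 / 3 : ℝ) * N + 1) := mul_le_mul_of_nonneg_right h1 hX
        _ = (N : ℝ) / 400 + 4 * ℓb ^ 2 / Real.pi ^ 2 := by rw [mul_add, mul_one, h2]
        _ ≤ (N : ℝ) / 400 + (N : ℝ) / 400 := add_le_add le_rfl hN1
        _ = (N : ℝ) / 200 := by ring
    have hS1 : ENNReal.ofReal (199 / 200 * (N : ℝ)) ≤ ∑ i, n i := by
      have hs0 : 0 ≤ (L / 2 ^ K) ^ 2 / Real.pi ^ 2 := by positivity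
      have hE0 : 0 ≤ ε * ρ ^ (2 / 3 : ℝ) * N := by positivity
      have h1 : ENNReal.ofReal ((L / 2 ^ K) ^ 2 / Real.pi ^ 2) * ∫⁻ X, kineticDensity Ψ.ψ X ≤
          ENNReal.ofReal ((N : ℝ) / 200) :=
        calc ENNReal.ofReal ((L / 2 ^ K) ^ 2 / Real.pi ^ 2) * ∫⁻ X, kineticDensity Ψ.ψ X
            ≤ ENNReal.ofReal ((L / 2 ^ K) ^ 2 / Real.pi ^ 2) *
                (ENNReal.ofReal (ε * ρ ^ (2 / 3 : ℝ) * N) + 1) := mul_le_mul' le_rfl hkin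
          _ = ENNReal.ofReal ((L / 2 ^ K) ^ 2 / Real.pi ^ 2) *
                ENNReal.ofReal (ε * ρ ^ (2 / 3 : ℝ) * N + 1) := by
              rw [ENNReal.ofReal_add hE0 zero_le_one, ENNReal.ofReal_one]
          _ = ENNReal.ofReal ((L / 2 ^ K) ^ 2 / Real.pi ^ 2 * (ε * ρ ^ (2 / 3 : ℝ) * N + 1)) :=
              (ENNReal.ofReal_mul hs0).symm
          _ ≤ ENNReal.ofReal ((N : ℝ) / 200) := ENNReal.ofReal_le_ofReal hloss
      have h2 : (N : ℝ≥0∞) = ENNReal.ofReal (199 / 200 * (N : ℝ)) + ENNReal.ofReal ((N : ℝ) / 200) := by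
        rw [← ENNReal.ofReal_add (by positivity) (by positivity), ← ENNReal.ofReal_natCast N]
        congr 1
        ring
      have h3 : ENNReal.ofReal (199 / 200 * (N : ℝ)) + ENNReal.ofReal ((N : ℝ) / 200) ≤
          (∑ i, n i) + ENNReal.ofReal ((N : ℝ) / 200) := by
        rw [← h2]
        exact hPK.trans (add_le_add le_rfl h1)
      exact (ENNReal.add_le_add_iff_right ENNReal.ofReal_ne_top).mp h3
    -- (7) truncated tangent-line Hölder
    exact sqrt_le_two_coherentAmplitude_of_ledger hN0 n m o hle hS1 hm2 ho

end Summit.AtomisticToContinuum.BoseEinsteinCondensation.Cruxes.BaseCoherentMass.Birth
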